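import Mathlib

/-!
# (B3)/(α′) — THEOREM I48: the i-half of «E = ker q ∕ im i locally free» for `D48 = (48,176)` on TWIST
# — kernel lemmas + predicate spec of the INCIDENCE CRITERION and its certificate (hsemireg-monad-4 g11)

hsemireg-monad-4 g11 (planner-hsemireg-monad-4-g11-0), 2026-08-30.  D-0145 token:
`line stmt-HodgeConjecture-18881 Cruxes/BlochSeedDiscOne/Lines/birth.lean 814a6a70c14e831a stub_rung_pad4_seedAt`.
Companion memo: `Cruxes/BlochSeedDiscOne/B3-ITHEOREM-D48-monad4-g11.md`; engine `ev11.py`, validation `deep11.py`,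
`valjoin11.py`; data `ev11-criterion-s{1,2}.txt`, `validation-s{1,2}.txt` (HOME g11/).

CENSUS-NEUTRAL.  Nothing in this file is a rung or a step toward HC / HC_CM / HC_AV / №4 / 26512 / 18881 / H2.
A letter design ≠ a V-configuration ≠ a monad ≠ a sheaf ≠ a SEED.  This file is evidence + a typed spec:
Mathlib-only, no `sorry`, no new axioms, no `instance`, no `notation`, no banned options.  The pen theorem of the memo
(THEOREM I48 = reduction §2 + incidence criterion §3) is NOT formalised here; what is kernel-checked is
(i) the block-triangular kernel shape behind `ker i(x) ≅ K(x)` (§1), (ii) the cofactor formula behind the conditions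
`C_w` (§1), (iii) the dimension bookkeeping of the criterion's proof and the soundness of the search prune (§2),
(iv) the numeric rows of the certificate and of the (B3) TABLE (`decide`, §3) over numbers computed EXACTLY mod p by
`ev11.py` (two seeds, byte-identical tables) and validated against the full model by `deep11.py` (44/44 strata × 2 seeds).

* §1 KERNEL.  For linear `T : V₁ → W₁`, `B : V₂ → W₁`, `E : V₂ → W₂` the block map `(a,g) ↦ (T a + B g, E g)` has
  trivial kernel iff `T` has trivial kernel and every `g` with `E g = 0` whose `B g` is hit by `-T` vanishes
  (`blockTriangular_kernel_iff`) — memo 2.4 with `T = ⊕ T_w` (towers), `E = EV`, and the solvability of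
  `T_w α = -(Bγ)_w` for a rank-2 `3×2` block read through `det [T_w | y] = π κ − ρ ν` (`cofactor_expansion`).
* §2 ARITHMETIC.  `incidence_nondominant`: if `ρ + c ≥ d + s`, `s ≥ 1` and `ρ + c ≤ N = dim Data` then
  `d + (s − 1) + (N − ρ − c) < N` — the bad incidence cannot dominate the data.  `prune_sound`: with `c ≥ s` and
  `d ≤ dimS ≤ ρ` the inequality is automatic (the search prune of memo §3 Remark 1).
* §3 SPEC (`decide`).  Factor states `33 = 1 + 8 + 24`, patterns `33⁴ = 1 185 921`, classes mod S₄ `58 905`; the 45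
  cells `(|D_T|,|D_A|) ↦ (classes, tight)` of the certificate with their sums; the tight examples as `CritNode`s with
  `f = 0`; min `f` by `|S|`; validation tallies; and the (B3) verdict row: `D48.alphaPrime = (Q8 16 ≤ 8 + 9) ∧ I48`.
-/

namespace Summit.HodgeConjecture.HodgeConjecture.Cruxes.BlochSeedDiscOne.B3IKernelD48

/-! ## §1 The block-triangular kernel shape and the cofactor formula -/
section Kernel

variable {K V₁ V₂ W₁ W₂ : Type*} [Field K]
  [AddCommGroup V₁] [Module K V₁] [AddCommGroup V₂] [Module K V₂]
  [AddCommGroup W₁] [Module K W₁] [AddCommGroup W₂] [Module K W₂]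

/-- Memo 2.4: after the row operation `i(x) ≅ [[T, B], [0, E]]`.  Its kernel is trivial iff `T` is injective on
vectors (`T a = 0 → a = 0`) and the only `γ` with `E γ = 0` and `T α + B γ = 0` solvable is `γ = 0`
(i.e. `K(x) = 0`). -/
theorem blockTriangular_kernel_iff (T : V₁ →ₗ[K] W₁) (B : V₂ →ₗ[K] W₁) (E : V₂ →ₗ[K] W₂) :
    (∀ a : V₁, ∀ g : V₂, T a + B g = 0 → E g = 0 → a = 0 ∧ g = 0) ↔
      ((∀ a : V₁, T a = 0 → a = 0) ∧
        ∀ g : V₂, E g = 0 → (∃ a : V₁, T a + B g = 0) → g = 0) := by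
  constructor
  · intro h
    refine ⟨fun a ha => ?_, fun g hE hex => ?_⟩
    · exact (h a 0 (by rw [map_zero, add_zero]; exact ha) (map_zero E)).1
    · obtain ⟨a, ha⟩ := hex
      exact (h a g ha hE).2
  · rintro ⟨hT, hC⟩ a g hTB hE
    have hg : g = 0 := hC g hE ⟨a, hTB⟩
    subst hg
    rw [map_zero, add_zero] at hTB
    exact ⟨hT a hTB, rfl⟩

/-- The same statement phrased with `Function.Injective` for the block map on the product. -/
theorem blockTriangular_injective_iff (T : V₁ →ₗ[K] W₁) (B : V₂ →ₗ[K] W₁) (E : V₂ →ₗ[K] W₂) :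
    Function.Injective (fun x : V₁ × V₂ => (T x.1 + B x.2, E x.2)) ↔
      ((∀ a : V₁, T a = 0 → a = 0) ∧
        ∀ g : V₂, E g = 0 → (∃ a : V₁, T a + B g = 0) → g = 0) := by
  rw [← blockTriangular_kernel_iff]
  constructor
  · intro hinj a g h1 h2
    have key : (fun x : V₁ × V₂ => (T x.1 + B x.2, E x.2)) (a, g) =
        (fun x : V₁ × V₂ => (T x.1 + B x.2, E x.2)) (0, 0) := by
      simp only [map_zero, add_zero]
      exact Prod.ext h1 h2
    have := hinj key
    exact ⟨congrArg Prod.fst this, congrArg Prod.snd this⟩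
  · intro h x y hxy
    obtain ⟨a, g⟩ := x
    obtain ⟨a', g'⟩ := y
    simp only [Prod.mk.injEq] at hxy
    obtain ⟨h1, h2⟩ := hxy
    have h1' : T (a - a') + B (g - g') = 0 := by
      rw [map_sub, map_sub]
      have : T a + B g - (T a' + B g') = 0 := sub_eq_zero.mpr h1
      calc T a - T a' + (B g - B g') = T a + B g - (T a' + B g') := by abel
        _ = 0 := this
    have h2' : E (g - g') = 0 := by rw [map_sub]; exact sub_eq_zero.mpr h2
    obtain ⟨ha, hg⟩ := h (a - a') (g - g') h1' h2'
    exact Prod.ext (sub_eq_zero.mp ha) (sub_eq_zero.mp hg)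

/-- Memo 2.4, the condition `C_w`: expanding `det [[a, b, 0], [c, d, ρ], [e, f, π]]` (the tower block `T_w` with
columns `(a,c,e)`, `(b,d,f)` on the rows N17, N30, λ, bordered by `y = (0, ρ, π)`) along the last column gives
`π·κ − ρ·ν` with `κ = ad − bc`, `ν = af − be`. -/
theorem cofactor_expansion {R : Type*} [CommRing R] (a b c d e f ρ π : R) :
    a * (d * π - ρ * f) - b * (c * π - ρ * e) = π * (a * d - b * c) - ρ * (a * f - b * e) := by
  ring

/-- With Mathlib's `Matrix.det`: the bordered `3×3` determinant equals `π κ − ρ ν`. -/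
theorem det_bordered_tower {R : Type*} [CommRing R] (a b c d e f ρ π : R) :
    Matrix.det !![a, b, 0; c, d, ρ; e, f, π] = π * (a * d - b * c) - ρ * (a * f - b * e) := by
  rw [Matrix.det_fin_three]
  simp only [Matrix.of_apply, Matrix.cons_val', Matrix.cons_val_zero, Matrix.cons_val_one,
    Matrix.cons_val_two, Matrix.empty_val', Matrix.cons_val_fin_one, Matrix.head_cons,
    Matrix.head_fin_const, Matrix.tail_cons]
  ring

/-- Independence of the two minors used in the atom lemma (memo §3 (ii)): if `κ L₁ + ν L₂ = 0` for the two value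
assignments `(κ,ν) = (1,0)` and `(0,1)` — both realised by tower data — then `L₁ = L₂ = 0`. -/
theorem minors_independent {R : Type*} [CommRing R] (L₁ L₂ : R)
    (h : ∀ κ ν : R, κ * L₁ + ν * L₂ = 0) : L₁ = 0 ∧ L₂ = 0 := by
  have h1 := h 1 0
  have h2 := h 0 1
  simp at h1 h2
  exact ⟨h1, h2⟩

end Kernel

/-! ## §2 The dimension bookkeeping of the INCIDENCE CRITERION -/
section Incidence

/-- The criterion node: `ρ` = rank of the active Ẽ-columns of `S`, `cC` = number of live cofactor conditions,
`dS` = dimension of the projection of the stratum to the coordinates `S` touches, `s = |S|`. -/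
structure CritNode where
  rho : ℕ
  cC : ℕ
  dS : ℕ
  s : ℕ
  deriving DecidableEq, Repr

/-- The inequality of the criterion, `ρ + c_C ≥ d_S + |S|`. -/
def CritNode.ok (n : CritNode) : Bool := decide (n.dS + n.s ≤ n.rho + n.cC)

/-- The slack `f = ρ + c_C − |S| − d_S` as an integer. -/
def CritNode.f (n : CritNode) : ℤ := (n.rho : ℤ) + n.cC - n.s - n.dS

theorem CritNode.ok_iff_f_nonneg (n : CritNode) : n.ok = true ↔ 0 ≤ n.f := by
  simp only [CritNode.ok, CritNode.f, decide_eq_true_eq]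
  omega

/-- Memo §3, proof of the THEOREM: the bad incidence `B'` lives over `pr(Σ) × ℙ(ℂ^S)` (dimension `≤ d + (s-1)`)
with fibres of codimension `ρ + c` in the data (dimension `N`); if the node is ok then `dim B' < N`, so `B'` cannot
dominate the data. -/
theorem incidence_nondominant (N ρ c d s : ℕ) (hs : 1 ≤ s) (hfit : ρ + c ≤ N) (hok : d + s ≤ ρ + c) :
    d + (s - 1) + (N - (ρ + c)) < N := by
  omega

/-- The same over all strata and supports at once: a finite union of non-dominant closed sets is non-dominant —
recorded as the counting statement «if every node is ok, no node reaches dimension `N`». -/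
theorem incidence_nondominant_all (N : ℕ) (nodes : List (ℕ × ℕ × ℕ × ℕ))
    (h : ∀ n ∈ nodes, 1 ≤ n.2.2.2 ∧ n.1 + n.2.1 ≤ N ∧ n.2.2.1 + n.2.2.2 ≤ n.1 + n.2.1) :
    ∀ n ∈ nodes, n.2.2.1 + (n.2.2.2 - 1) + (N - (n.1 + n.2.1)) < N := by
  intro n hn
  obtain ⟨hs, hfit, hok⟩ := h n hn
  exact incidence_nondominant N n.1 n.2.1 n.2.2.1 n.2.2.2 hs hfit hok

/-- Memo §3 Remark 1 (soundness of the search prune): `c_C ≥ |S|` always and `d_S ≤ dim Σ`; so once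
`ρ(S₀) ≥ dim Σ`, every `S ⊇ S₀` (whose `ρ` is at least `ρ(S₀)`) satisfies the criterion without being visited. -/
theorem prune_sound (ρ₀ ρ c d s dimS : ℕ) (hmono : ρ₀ ≤ ρ) (hprune : dimS ≤ ρ₀) (hc : s ≤ c) (hd : d ≤ dimS) :
    d + s ≤ ρ + c := by
  omega

/-- Rank bookkeeping of (α′) for D48 once both halves hold at every point: `rk E = r_N − r_A − c`. -/
theorem rankE_D48 : 112 - 48 - 16 = 48 := by decide

end Incidence

/-! ## §3 SPEC rows (numbers from `ev11.py --criterion`, seeds 1 and 2 byte-identical; `decide`) -/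
namespace I48

/-- Admissible kill states of one factor: none; one T/𝒜 kill on one of 4 chains; two kills on two distinct chains. -/
theorem factorStates : 1 + 4 * 2 + Nat.choose 4 2 * 2 * 2 = 33 := by decide

theorem patterns_total : 33 ^ 4 = 1185921 := by norm_num

/-- Classes mod S₄ = multisets of size 4 from 33 states = C(36,4). -/
theorem classes_total : (36 * 35 * 34 * 33) / 24 = 58905 := by norm_num

/-- The certificate table: `(|D_T|, |D_A|, classes, classes with a tight S (f = 0))`; no class has `f < 0`. -/
def classCounts : List (ℕ × ℕ × ℕ × ℕ) :=
  [(0,0,1,0), (0,1,4,0), (0,2,16,0), (0,3,44,0), (0,4,116,4), (0,5,204,0), (0,6,266,0), (0,7,224,0), (0,8,126,0),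
   (1,0,4,4), (1,1,28,28), (1,2,112,100), (1,3,368,284), (1,4,852,528), (1,5,1308,528), (1,6,1232,328), (1,7,672,120),
   (2,0,16,16), (2,1,112,112), (2,2,526,482), (2,3,1584,1304), (2,4,3096,1974), (2,5,3384,1460), (2,6,1974,532),
   (3,0,44,44), (3,1,368,364), (3,2,1584,1476), (3,3,4060,3240), (3,4,5560,3232), (3,5,3696,1312),
   (4,0,116,114), (4,1,852,836), (4,2,3096,2770), (4,3,5560,3944), (4,4,4614,2074),
   (5,0,204,200), (5,1,1308,1240), (5,2,3384,2720), (5,3,3696,1980),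
   (6,0,266,256), (6,1,1232,1080), (6,2,1974,1194), (7,0,224,212), (7,1,672,464), (8,0,126,100)]

theorem classCounts_cells : classCounts.length = 45 := by decide

theorem classCounts_sum : (classCounts.map (fun t => t.2.2.1)).sum = 58905 := by decide

theorem classCounts_tight : (classCounts.map (fun t => t.2.2.2)).sum = 36656 := by decide

/-- Every cell has at most two kills per factor: `|D_T| + |D_A| ≤ 8`. -/
theorem classCounts_admissible : classCounts.all (fun t => decide (t.1 + t.2.1 ≤ 8)) = true := by decide

/-- VIOLATIONS (f < 0) over all 58 905 classes and all supports S: none (both seeds). -/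
def violations : ℕ := 0
/-- Strata whose general point carries a kernel vector for general atoms: none. -/
def genericKernelStrata : ℕ := 0
/-- S-nodes visited by the pruned complete search (per seed). -/
def sNodesVisited : ℕ := 1939558

/-- Minimum of `f` by support size `|S| = 1..6` over all visited nodes (sizes ≥ 7 are never reached: pruned). -/
def minFBySize : List (ℕ × ℤ) := [(1,0), (2,0), (3,0), (4,0), (5,2), (6,4)]

theorem minF_nonneg : minFBySize.all (fun t => decide (0 ≤ t.2)) = true := by decide

/-- The tight examples printed by the engine (memo §4), as criterion nodes `(ρ, c_C, d_S, |S|)`. -/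
def tightSingletonT1 : CritNode := ⟨3, 1, 3, 1⟩      -- D_T = {(3,1)}, S = {(3,i)}
def tightPureA4 : CritNode := ⟨0, 8, 4, 4⟩           -- D_A = {(k,1) : all k}, S = {(k,−1) : all k}
def tightDeep80 : CritNode := ⟨0, 1, 0, 1⟩           -- |D_T| = 8 maximal, S = {(0,i)}
def tightMixed12 : CritNode := ⟨2, 1, 2, 1⟩          -- D_T = {(2,1)}, D_A = {(3,1),(3,−i)}, S = {(2,i)}
def genericSingleton : CritNode := ⟨3, 4, 4, 1⟩      -- no kills, S = {u}: f = 2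

theorem tight_rows :
    tightSingletonT1.ok = true ∧ tightSingletonT1.f = 0 ∧ tightPureA4.ok = true ∧ tightPureA4.f = 0 ∧
    tightDeep80.ok = true ∧ tightDeep80.f = 0 ∧ tightMixed12.ok = true ∧ tightMixed12.f = 0 ∧
    genericSingleton.ok = true ∧ genericSingleton.f = 2 := by decide

/-- A node that WOULD violate the criterion (none occurs): shown only to exhibit that `ok` is not vacuous. -/
theorem ok_not_vacuous : (⟨0, 1, 1, 1⟩ : CritNode).ok = false := by decide

/-- Structure constants of the reduced model (memo 2.5, `ev11.py --kernels`). -/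
def rankEtildeEmpty : ℕ := 36
theorem coker_Etilde : 48 - rankEtildeEmpty = 12 := by decide   -- = dim S, forced by q∘i = 0

/-- Validation tallies (memo §5): strata compared / agreeing, per full-model seed; S₄-symmetry test. -/
def validation : List (String × ℕ × ℕ) :=
  [("deep11 seed 1: (ker EV_live, ker i, 16 position ranks) agree", 44, 44),
   ("deep11 seed 2: idem", 44, 44),
   ("ev11 symtest: S4-invariance of (min f, ker EV_live, ker EV, ker i)", 200, 200)]

theorem validation_clean : validation.all (fun t => decide (t.2.1 = t.2.2)) = true := by decide

/-- The certificate flag of THEOREM I48 for (D48, TWIST): violations = 0 and no generic-kernel stratum. -/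
def certificate : Bool := decide (violations = 0 ∧ genericKernelStrata = 0)

theorem certificate_holds : certificate = true := by decide

end I48

/-! ## §3b The (B3) TABLE row for D48 after g11 -/
namespace Road

/-- THEOREM Q8 (g10): q onto everywhere iff `c ≤ 8 + a₈(𝒱)` (general N18); `a₈(TWIST) = 9`. -/
def q8ok (c a8 : ℕ) : Bool := decide (c ≤ 8 + a8)

/-- The (α′) rows of one design on one V-configuration. -/
structure AlphaPrimeRow where
  name : String
  c : ℕ
  a8 : ℕ
  hubInN : Bool
  iCertificate : Bool     -- THEOREM I48-type certificate run and clean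
  deriving Repr

def AlphaPrimeRow.qSide (r : AlphaPrimeRow) : Bool := q8ok r.c r.a8
def AlphaPrimeRow.iSide (r : AlphaPrimeRow) : Bool := !r.hubInN && r.iCertificate
/-- (α′) = E locally free of the design rank and class (letter level, general data): both halves. -/
def AlphaPrimeRow.alphaPrime (r : AlphaPrimeRow) : Bool := r.qSide && r.iSide

def D48twist : AlphaPrimeRow := ⟨"D48=(48,176) on TWIST, c16", 16, 9, false, true⟩
def T40twist : AlphaPrimeRow := ⟨"T40=(40,184) on TWIST, c24", 24, 9, false, false⟩
def O162twist : AlphaPrimeRow := ⟨"O162=(32,162) on TWIST, c17, hub ∈ N", 17, 9, true, false⟩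

theorem d48_alphaPrime : D48twist.alphaPrime = true ∧ D48twist.qSide = true ∧ D48twist.iSide = true := by decide

theorem others_off : T40twist.alphaPrime = false ∧ O162twist.alphaPrime = false := by decide

/-- rank and the three MINT designs of the task line (inherited verdicts, restated as data; nothing computed). -/
def mintThree : List (String × String) :=
  [("ac808a66 = 08162ddb", "(α′) fails at class level for every monad — COROLLARY LF ×2"),
   ("bf2edc09", "(α′) fails at class level for every monad — COROLLARY LF ×2"),
   ("1840bf64", "carrier VOID — M72 closed ×2; (α′) has no object")]

theorem mintThree_count : mintThree.length = 3 := by decide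

end Road

end Summit.HodgeConjecture.HodgeConjecture.Cruxes.BlochSeedDiscOne.B3IKernelD48
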